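import Summits.QuantumFields.YangMills.Theorems.BalabanUVNodesN21ShellSplitSelected13CoPH
import Summits.QuantumFields.YangMills.Theorems.BalabanUVNodesN21ShellSplitOfRecord13CoPHKeyed
import Summits.QuantumFields.YangMills.Theorems.BalabanUVNodesN21StepWeightsPositivity
import Literature.MathematicalPhysics.QuantumFieldTheory.Balaban1983to89.Node00.Record12MeasurabilityAbsolute

/-!
# N21 (NE7c) · THE SELECTED TOP CUT AT THE RECORD: the pigeonhole at the record's terms with g9's COUNT, and `T4IndicatorShell.ShellWeightBound` at the reading's
# carriers `(classSet₁₃, weightA₁₃, weightB₁₃, bandA₁₃, bandB₁₃)` and AT `crOfRecord₁₃At K₀ jcut (shellSplitSelected₁₃At N K₀ ρ n)` with weights `K ↦ 2(2L^m)⁴∕(n_K + 1)` —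
# NO anti-concentration hypothesis; on the live-selector line with n20-d's extraction rows only

R134 seat `pub-ymgap-dag-n21-d` (g10), node N21 = NE7c (NOT PRINTED, NOT proved at print's fixed thresholds), strategy s2; lane K3⁷ `SpineGivenEndpointR13SepCoPH`
(stmt-QuantumFields-20544, `--supports … --as helper`; COUNT-NEUTRAL).  Imports the generic term-level file `…N21ShellSplitSelected13CoPH` (§8–§10: disjointness, cover,
pigeonhole, argmin, the band integrand's range) and g9's keyed file `…N21ShellSplitOfRecord13CoPHKeyed` (p593341: `sum_classSet₁₃_weightA₁₃ ∕ _weightB₁₃`,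
`integrable_topPieceA∕B_of_liveSel`; through it g9 FILE 2's `chiSeqOfRecord_mul_chiSeqOfRecordAt_of_le`, `classWeightOfDatum₉_nonneg'`, `card_cubeIndices_top_le` and n20-d's
transfer `shellWeightBound_crOfRecord₁₃At`), this seat's (POS)-ζ module `…N21StepWeightsPositivity` (p496248: `zetaOfRecord_nonneg`) and K0c's
`Node00/Record12MeasurabilityAbsolute` (p488525: the ABSOLUTE (H-U) `localBgMeasurable`).

WHAT THIS FILE PROVES (theorems only; 0 `def`, 0 `sorry`).
* §11 AT THE RECORD's TERMS (`W_i(s) := χ_k^{ε_k}(s)·slot_s` for every depth, `env :=` the dressed density): (R) `bandWeightOfDatum₉_nonneg ∕ _le_classWeight` (NO sign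
  hypothesis on `ε_k`, `ρ`), ★ `bandWeightOfDatum₉_top` (the band at depth `0` IS g9's shell part of record), ★★ `sum_range_sum_bandWeight_le` (`Σ_{i<m} Σ_s band_s(θ_i, θ_{i+1})
  ≤ (2L^m)⁴ · Σ_s classWeight_s` for `ρ ≤ 1` — g9's COUNT), and the window of the grid `cutGrid_le ∕ cutGrid_ge` (for `0 ≤ ρ ≤ 1`, `0 ≤ ε_k`: `ε_k(1−ρ)^n ≤ θ_i ≤ ε_k`, `i ≤ n`).
* §12 the class-set sums of the keyed bands are the runs' band masses at the selected depth (`sum_classSet₁₃_bandA₁₃ ∕ _bandB₁₃`); (R): `bandA₁₃_nonneg ∕ bandB₁₃_nonneg ∕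
  bandA₁₃_le_weightA₁₃ ∕ bandB₁₃_le_weightB₁₃` (NO sign hypothesis on the letters).
* §13 ★★ `bandSum_selDepth_le`: at the selected depth `i⋆(K,t)`, `Σ_s band^A_{i⋆} ≤ (2(2L^m)⁴∕(n+1))·Σ_s A` AND `Σ_s band^B_{i⋆} ≤ (2(2L^m)⁴∕(n+1))·Σ_s B` (§11's pigeonhole in
  each run + §10's argmin; displayed: (H-U), `0 ≤ ζ`, F3's (e1) integrability, `ρ_K ≤ 1`).
* §14 ★★★ `shellWeightBound_classSet₁₃_selected` — `ShellWeightBound 1 (classSet₁₃ θ K₀ g₀) (weightA₁₃ …) (weightB₁₃ …) (bandA₁₃ … ρ n) (bandB₁₃ … ρ n)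
  (K ↦ 2(2L^m)⁴·(1∕(n_K + 1)))` from `ρ_K ≤ 1`, `Summable (K ↦ 1∕(n_K + 1))` and the displayed rows ONLY; ★★★ `shellWeightBound_crOfRecord₁₃At_shellSplitSelected` (n20-d's
  transfer, canonical `Wsh`); ★★★ `shellWeightBound_crOfRecord₁₃At_shellSplitSelected_of_liveSel` (F3's (e1) a THEOREM on the live line, g9 FILE 3 §6: displayed rows =
  n20-d's extraction rows `hsel`, (H-U), (H-ζ), `0 ≤ ζ` + the two letter rows) and ★★★ `…_of_liveSel'` (rows = `hsel`, (H-ζ) + the two letter rows: (H-U) is K0c's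
  absolute `Node00.localBgMeasurable`, `0 ≤ ζ` is the provisos' via this seat's `zetaOfRecord_nonneg`).  NO `SlotAntiConcentration`, NO estimate of Bałaban's.

HONEST FRAMING (binding, A6-grade).  The first inhabitant of `ShellSplit₁₃CoPH` at the reading of record whose `ShellWeightBound` is a THEOREM with bands of POSITIVE
relative width — but AT THE READING OF RECORD the terms carry their sharp top cut at print's `ε_k` (front factor and (3.2) weight), and the selected band
`[θ_{i⋆+1}, θ_{i⋆})`, `θ_i = ε_k(1 − ρ_K)^i`, is adjacent to that cut only when `i⋆ = 0`: for a consumer matching the record's `ε_k`-cut terms (T4IndicatorShell design (i)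
AT `ε_k`; N19′'s core) this split is worth NO MORE than the zero split (dag-n20-w2 `…N21KeyedShellWeightShellZero`).  Its consumer is the THRESHOLD-LETTER reading (top
front factor and (3.2) weight at the SELECTED letter `Θ_k := θ_{i⋆}(K,t)`, def-T FILE 19), where the band IS design (i)'s single-run shell and §10 of the companion applies
verbatim — LOCATED on the cell bus (lettered dressed family, lettered E1∕E2, lettered reading, `PinnedAtLive` admitting it), NOT typed here.  `ρ ∕ n` are LETTERS;
`jcut` not read; no `Provisos₁₃CoPH` inhabitant claimed (K0⁷ open); NE7c NOT PRINTED ∕ NOT proved at print's thresholds; N21 NOT discharged; K3⁷ NOT claimed; counts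
UNMOVED (typed 28∕28 · discharged 5∕27); never a count claim.  No `instance`, no `notation`, no `def`.  One finite four-torus programme at fixed `ε` — NOT ℝ⁴, NOT OS,
NOT a mass gap, NOT the Clay problem.
-/

noncomputable section

open scoped BigOperators
open Finset MeasureTheory

namespace Summit.QuantumFields.YangMills.Theorems.N21ShellSplitOfRecord13CoPH

open Literature.MathematicalPhysics.QuantumFieldTheory.Balaban1983to89
open Literature.MathematicalPhysics.QuantumFieldTheory.Balaban1983to89.T4Continuum
open Literature.MathematicalPhysics.QuantumFieldTheory.Balaban1983to89.Node00
open T4IndicatorShell (ShellWeightBound)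
open YMDAG.UVSplit (crOfRecord₁₃At ShellSplit₁₃CoPH keyA₁₃ keyB₁₃ runA₁₃ runB₁₃ histA₁₃ histB₁₃ classSet₁₃ weightA₁₃ weightB₁₃
  shellWeightBound_crOfRecord₁₃At)
open Summit.QuantumFields.YangMills.BalabanUVNodes.N19MGFFormAtRecord (wOfRecord₉_nonneg)
open Summit.QuantumFields.YangMills.BalabanUVNodes.N19MGFRoadLiveSelectorTower (dressedSlotsOfDatum₉_nonneg)
open Summit.QuantumFields.YangMills.Theorems.N21StepWeightsPositivity (zetaOfRecord_nonneg)

/-! ## §11 At the record's terms: the (R)-fields of the band, the band at depth `0`, the pigeonhole with g9's COUNT, the window of the grid -/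

section Term

variable (F : T4Family) (N : ℕ) [NeZero N] (ϑ : Stage9Params F N) (D : FiniteEpsData F (SU N)) (g₀ : ℕ → ℝ) (os : List (ULoop F))
  (p : B12.RunParams) (g : ℕ → ℝ) (k : ℕ)

/-- ★ **THE BAND IS NONNEGATIVE.** [bookkeeping] -/
theorem bandWeightOfDatum₉_nonneg (hw0 : ∀ k s' U V', 0 ≤ wOfRecord₉ F N ϑ p g k s' U V') (θ θ' t : ℝ) (s : SeqOfRecord F ϑ.ν ϑ.τ9.M g p.K k) :
    0 ≤ bandWeightOfDatum₉ F N ϑ D g₀ os p g k θ θ' t s :=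
  integral_nonneg fun V => bandIntegrand_nonneg F N ϑ D g₀ os p g k hw0 θ θ' t s V

/-- ★ **THE BAND NEVER EXCEEDS THE CLASS WEIGHT** (displayed: F3's (e1) integrability of `χ_k(s)·slot_s`; NO sign hypothesis on the letters). [bookkeeping] -/
theorem bandWeightOfDatum₉_le_classWeight (hw0 : ∀ k s' U V', 0 ≤ wOfRecord₉ F N ϑ p g k s' U V') (θ θ' t : ℝ) (s : SeqOfRecord F ϑ.ν ϑ.τ9.M g p.K k)
    (hint : Integrable (fun V => chiSeqOfRecord F N ϑ.ν ϑ.τ9.M g p.K k s V * dressedSlotsOfDatum₉ F N ϑ D g₀ os t p g k s V)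
      (fieldMeasure (F.P p.K) k (SU N))) :
    bandWeightOfDatum₉ F N ϑ D g₀ os p g k θ θ' t s ≤ classWeightOfDatum₉ F N ϑ D g₀ os p g k t s :=
  integral_mono_of_nonneg (ae_of_all _ fun V => bandIntegrand_nonneg F N ϑ D g₀ os p g k hw0 θ θ' t s V) hint
    (ae_of_all _ fun V => bandIntegrand_le F N ϑ D g₀ os p g k hw0 θ θ' t s V)

/-- ★ **THE BAND AT DEPTH `0` IS g9's SHELL PART OF RECORD**: `band_s(ε_k, ε_k(1 − ρ)) = shellWeightOfDatum₉ … ρ t s` (`χ_k·χ_k^{ε_k} = χ_k`, `{0,1}`-valued). [bookkeeping] -/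
theorem bandWeightOfDatum₉_top (ρ t : ℝ) (s : SeqOfRecord F ϑ.ν ϑ.τ9.M g p.K k) :
    bandWeightOfDatum₉ F N ϑ D g₀ os p g k (cutGrid ϑ.ν g k ρ 0) (cutGrid ϑ.ν g k ρ 1) t s = shellWeightOfDatum₉ F N ϑ D g₀ os p g k ρ t s := by
  unfold bandWeightOfDatum₉ shellWeightOfDatum₉
  refine integral_congr_ae (ae_of_all _ fun V => ?_)
  have hsq := chiSeqOfRecord_mul_chiSeqOfRecordAt_of_le F N ϑ p g k (le_refl (epsOfRecord ϑ.ν g k)) s V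
  rw [← chiSeqOfRecord_eq_at] at hsq
  simp only [cutGrid, pow_zero, mul_one, pow_one]
  rw [← mul_assoc, ← chiSeqOfRecord_eq_at, hsq]

/-- ★★ **THE PIGEONHOLE AT THE RECORD's TERMS WITH g9's COUNT**: for `ρ ≤ 1` (the grid `θ_i = ε_k(1 − ρ)^i` is antitone or monotone — NO sign hypothesis on `ε_k`),
under (H-U), `0 ≤ w` and F3's (e1) integrability, `Σ_{i<m} Σ_s band_s(θ_i, θ_{i+1}) ≤ (2L^m)⁴ · Σ_s classWeight_s` (§10 with `W_i(s) := χ_k^{ε_k}(s)·slot_s`, `env :=` the dressed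
density; `#(top cubes) ≤ (2L^m)⁴`, `card_cubeIndices_top_le` — at the top level `k = p.K`). [bookkeeping] -/
theorem sum_range_sum_bandWeight_le (hU : LocalBgMeasurable F N ϑ.ν) (hw0 : ∀ k s' U V', 0 ≤ wOfRecord₉ F N ϑ p g k s' U V') (hk : k = p.K)
    {ρ : ℝ} (hρ : ρ ≤ 1) (m : ℕ) (t : ℝ)
    (hint : ∀ s : SeqOfRecord F ϑ.ν ϑ.τ9.M g p.K k,
      Integrable (fun V => chiSeqOfRecord F N ϑ.ν ϑ.τ9.M g p.K k s V * dressedSlotsOfDatum₉ F N ϑ D g₀ os t p g k s V) (fieldMeasure (F.P p.K) k (SU N))) :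
    ∑ i ∈ Finset.range m, ∑ s, bandWeightOfDatum₉ F N ϑ D g₀ os p g k (cutGrid ϑ.ν g k ρ i) (cutGrid ϑ.ν g k ρ (i + 1)) t s ≤
      (2 * (F.L : ℝ) ^ F.m) ^ 4 * ∑ s, classWeightOfDatum₉ F N ϑ D g₀ os p g k t s := by
  -- the grid is antitone or monotone
  have hθ : (∀ i, cutGrid ϑ.ν g k ρ (i + 1) ≤ cutGrid ϑ.ν g k ρ i) ∨ (∀ i, cutGrid ϑ.ν g k ρ i ≤ cutGrid ϑ.ν g k ρ (i + 1)) :=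
    geom_dichotomy (epsOfRecord ϑ.ν g k) (1 - ρ) (by linarith)
  -- §10 with the record's (e1)-pieces as slots at every depth and the dressed density as envelope
  set W : ℕ → SeqOfRecord F ϑ.ν ϑ.τ9.M g p.K k → GaugeField (F.P p.K) k (SU N) → ℝ :=
    fun _ s V => chiSeqOfRecord F N ϑ.ν ϑ.τ9.M g p.K k s V * dressedSlotsOfDatum₉ F N ϑ D g₀ os t p g k s V with hWdef
  have hW0 : ∀ i s V, 0 ≤ W i s V := fun i s V =>
    mul_nonneg (chiSeqOfRecord_nonneg F N ϑ.ν ϑ.τ9.M g p.K k s V) (dressedSlotsOfDatum₉_nonneg F N ϑ D g₀ os p g hw0 t k s V)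
  have hWint : ∀ i s, Integrable (fun V => chiSeqOfRecordAt F N ϑ.ν ϑ.τ9.M g p.K k (cutGrid ϑ.ν g k ρ i) s V * W i s V)
      (fieldMeasure (F.P p.K) k (SU N)) := by
    intro i s
    exact (hint s).bdd_mul (c := 1) ((measurable_chiSeqOfRecordAt_of_localBg hU ϑ.τ9.M g p.K k _ s).aestronglyMeasurable)
      (ae_of_all _ fun V => by
        rw [Real.norm_eq_abs]
        exact abs_chiSeqOfRecordAt_le_one F N ϑ.ν ϑ.τ9.M g p.K k _ s V)
  have henv : ∀ i V, ∑ s, chiSeqOfRecordAt F N ϑ.ν ϑ.τ9.M g p.K k (cutGrid ϑ.ν g k ρ i) s V * W i s V ≤ ∑ s, W 0 s V := fun i V =>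
    Finset.sum_le_sum fun s _ => by
      simp only [hWdef]
      exact mul_le_of_le_one_left (hW0 0 s V) (chiSeqOfRecordAt_le_one F N ϑ.ν ϑ.τ9.M g p.K k _ s V)
  have henvint : Integrable (fun V => ∑ s, W 0 s V) (fieldMeasure (F.P p.K) k (SU N)) := integrable_finsetSum _ fun s _ => hint s
  have h10 := sum_range_sum_band_le_card_mul F N ϑ p g k hU hθ m W hW0 hWint _ henvint henv
  -- identify the band of record with §10's band (`χ_k·(χ^{θ}(1−χ^{θ′}))·slot = χ^{θ}(1−χ^{θ′})·(χ_k·slot)`) and the envelope's mass with the partition sum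
  have hlhs : ∀ i s, bandWeightOfDatum₉ F N ϑ D g₀ os p g k (cutGrid ϑ.ν g k ρ i) (cutGrid ϑ.ν g k ρ (i + 1)) t s =
      ∫ V, chiSeqOfRecordAt F N ϑ.ν ϑ.τ9.M g p.K k (cutGrid ϑ.ν g k ρ i) s V *
        (1 - chiSeqOfRecordAt F N ϑ.ν ϑ.τ9.M g p.K k (cutGrid ϑ.ν g k ρ (i + 1)) s V) * W i s V ∂fieldMeasure (F.P p.K) k (SU N) := by
    intro i s
    unfold bandWeightOfDatum₉
    refine integral_congr_ae (ae_of_all _ fun V => ?_)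
    simp only [hWdef]
    ring
  have hrhs : ∫ V, ∑ s, W 0 s V ∂fieldMeasure (F.P p.K) k (SU N) = ∑ s, classWeightOfDatum₉ F N ϑ D g₀ os p g k t s := by
    rw [integral_finsetSum _ fun s _ => hint s]
    rfl
  simp_rw [hlhs]
  refine h10.trans ?_
  rw [hrhs]
  refine mul_le_mul_of_nonneg_right ?_ (Finset.sum_nonneg fun s _ => classWeightOfDatum₉_nonneg' F N ϑ D g₀ os p g k hw0 t s)
  subst hk
  exact card_cubeIndices_top_le F p.K _ _

variable {F N ϑ D g₀ os p g} in
/-- the grid stays below the threshold of record (for `0 ≤ ε_k`, `0 ≤ ρ ≤ 1`). [bookkeeping] -/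
theorem cutGrid_le (hε : 0 ≤ epsOfRecord ϑ.ν g k) {ρ : ℝ} (hρ0 : 0 ≤ ρ) (hρ1 : ρ ≤ 1) (i : ℕ) :
    cutGrid ϑ.ν g k ρ i ≤ epsOfRecord ϑ.ν g k :=
  mul_le_of_le_one_right hε (pow_le_one₀ (by linarith) (by linarith))

variable {F N ϑ D g₀ os p g} in
/-- … and above `ε_k(1 − ρ)^n` down to depth `n` (the WINDOW in which the selected cut lies). [bookkeeping] -/
theorem cutGrid_ge (hε : 0 ≤ epsOfRecord ϑ.ν g k) {ρ : ℝ} (hρ0 : 0 ≤ ρ) (hρ1 : ρ ≤ 1) {i n : ℕ} (hi : i ≤ n) :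
    epsOfRecord ϑ.ν g k * (1 - ρ) ^ n ≤ cutGrid ϑ.ν g k ρ i :=
  mul_le_mul_of_nonneg_left (pow_le_pow_of_le_one (by linarith) (by linarith) hi) hε

end Term

/-! ## §12 Fibre sums and the (R)-fields of the keyed bands -/

section AtRecord

variable {F : T4Family} {N : ℕ} [NeZero N]

/-- run A: over the class set of record the keyed bands sum to the run's band mass at the selected depth (keys land in the class set). [bookkeeping] -/
theorem sum_classSet₁₃_bandA₁₃ (K₀ : ℕ) (θ : Stage13HParams F N) (hP : θ.Provisos₁₃CoPH F N) (g₀ : ℕ → ℝ) (os : List (ULoop F)) (ρ : ℕ → ℝ) (n : ℕ → ℕ)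
    (K : ℕ) (t : ℝ) :
    ∑ x ∈ classSet₁₃ θ K₀ g₀ K, bandA₁₃ θ hP K₀ g₀ os ρ n K t x =
      bandSumA₁₃ θ hP K₀ g₀ os ρ K (selDepth₁₃ θ hP K₀ g₀ os ρ (n K) K t) t := by
  letI : ∀ Kc, DecidableEq (SiteSeqKey F Kc) := fun _ => Classical.decEq _
  exact Finset.sum_fiberwise_of_maps_to (s := Finset.univ) (t := classSet₁₃ θ K₀ g₀ K) (g := keyA₁₃ θ K₀ g₀ K)
    (fun s _ => Finset.mem_union_left _ (Finset.mem_image_of_mem _ (Finset.mem_univ s))) _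

/-- run B: over the class set of record the keyed bands sum to the run's band mass at the selected depth. [bookkeeping] -/
theorem sum_classSet₁₃_bandB₁₃ (K₀ : ℕ) (θ : Stage13HParams F N) (hP : θ.Provisos₁₃CoPH F N) (g₀ : ℕ → ℝ) (os : List (ULoop F)) (ρ : ℕ → ℝ) (n : ℕ → ℕ)
    (K : ℕ) (t : ℝ) :
    ∑ x ∈ classSet₁₃ θ K₀ g₀ K, bandB₁₃ θ hP K₀ g₀ os ρ n K t x =
      bandSumB₁₃ θ hP K₀ g₀ os ρ K (selDepth₁₃ θ hP K₀ g₀ os ρ (n K) K t) t := by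
  letI : ∀ Kc, DecidableEq (SiteSeqKey F Kc) := fun _ => Classical.decEq _
  exact Finset.sum_fiberwise_of_maps_to (s := Finset.univ) (t := classSet₁₃ θ K₀ g₀ K) (g := keyB₁₃ θ K₀ g₀ K)
    (fun s' _ => Finset.mem_union_right _ (Finset.mem_image_of_mem _ (Finset.mem_univ s'))) _

/-- run A: the class-set sum of the keyed weights is the run's dressed partition sum (g9 FILE 3 `sum_classSet₁₃_weightA₁₃`, renamed object). [bookkeeping] -/
theorem sum_classSet₁₃_weightA₁₃_eq_massA (K₀ : ℕ) (θ : Stage13HParams F N) (hP : θ.Provisos₁₃CoPH F N) (g₀ : ℕ → ℝ) (os : List (ULoop F)) (K : ℕ) (t : ℝ) :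
    ∑ x ∈ classSet₁₃ θ K₀ g₀ K, weightA₁₃ θ hP K₀ g₀ os K t x = massA₁₃ θ hP K₀ g₀ os K t :=
  sum_classSet₁₃_weightA₁₃ K₀ θ hP g₀ os K t

/-- run B: the class-set sum of the keyed weights is the run's dressed partition sum. [bookkeeping] -/
theorem sum_classSet₁₃_weightB₁₃_eq_massB (K₀ : ℕ) (θ : Stage13HParams F N) (hP : θ.Provisos₁₃CoPH F N) (g₀ : ℕ → ℝ) (os : List (ULoop F)) (K : ℕ) (t : ℝ) :
    ∑ x ∈ classSet₁₃ θ K₀ g₀ K, weightB₁₃ θ hP K₀ g₀ os K t x = massB₁₃ θ hP K₀ g₀ os K t :=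
  sum_classSet₁₃_weightB₁₃ K₀ θ hP g₀ os K t

/-- run A: the keyed band is nonnegative (`0 ≤ ζ`). [bookkeeping] -/
theorem bandA₁₃_nonneg (K₀ : ℕ) (θ : Stage13HParams F N) (hP : θ.Provisos₁₃CoPH F N) (g₀ : ℕ → ℝ) (os : List (ULoop F))
    (hζ0 : ∀ p g k s Pl Ql RS U V', 0 ≤ θ.ζ p g k s Pl Ql RS U V') (ρ : ℕ → ℝ) (n : ℕ → ℕ) (K : ℕ) (t : ℝ) (x : Σ K, SiteSeqKey F (K₀ + K)) :
    0 ≤ bandA₁₃ θ hP K₀ g₀ os ρ n K t x :=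
  Finset.sum_nonneg fun s _ => bandWeightOfDatum₉_nonneg F N θ.toStage9Params (datumOfRecord₁₃CoPH F N θ hP) g₀ os (runA₁₃ F K₀ g₀ K)
    (histA₁₃ θ K₀ g₀ K) (K₀ + K) (wOfRecord₉_nonneg θ.toStage9Params hζ0 _ _) _ _ t s

/-- run B: the keyed band is nonnegative. [bookkeeping] -/
theorem bandB₁₃_nonneg (K₀ : ℕ) (θ : Stage13HParams F N) (hP : θ.Provisos₁₃CoPH F N) (g₀ : ℕ → ℝ) (os : List (ULoop F))
    (hζ0 : ∀ p g k s Pl Ql RS U V', 0 ≤ θ.ζ p g k s Pl Ql RS U V') (ρ : ℕ → ℝ) (n : ℕ → ℕ) (K : ℕ) (t : ℝ) (x : Σ K, SiteSeqKey F (K₀ + K)) :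
    0 ≤ bandB₁₃ θ hP K₀ g₀ os ρ n K t x :=
  Finset.sum_nonneg fun s' _ => bandWeightOfDatum₉_nonneg F N θ.toStage9Params (datumOfRecord₁₃CoPH F N θ hP) g₀ os (runB₁₃ F K₀ g₀ K)
    (histB₁₃ θ K₀ g₀ K) (K₀ + K + 1) (wOfRecord₉_nonneg θ.toStage9Params hζ0 _ _) _ _ t s'

/-- run A: the keyed band never exceeds the keyed class weight (F3's (e1) integrability displayed). [bookkeeping] -/
theorem bandA₁₃_le_weightA₁₃ (K₀ : ℕ) (θ : Stage13HParams F N) (hP : θ.Provisos₁₃CoPH F N) (g₀ : ℕ → ℝ) (os : List (ULoop F))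
    (hζ0 : ∀ p g k s Pl Ql RS U V', 0 ≤ θ.ζ p g k s Pl Ql RS U V')
    (hintA : ∀ (K : ℕ) (t : ℝ) (s : SeqOfRecord F θ.ν θ.τ9.M (histA₁₃ θ K₀ g₀ K) (K₀ + K) (K₀ + K)),
      Integrable (fun V => chiSeqOfRecord F N θ.ν θ.τ9.M (histA₁₃ θ K₀ g₀ K) (K₀ + K) (K₀ + K) s V *
        dressedSlotsOfDatum₉ F N θ.toStage9Params (datumOfRecord₁₃CoPH F N θ hP) g₀ os t (runA₁₃ F K₀ g₀ K) (histA₁₃ θ K₀ g₀ K) (K₀ + K) s V)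
        (fieldMeasure (F.P (K₀ + K)) (K₀ + K) (SU N)))
    (ρ : ℕ → ℝ) (n : ℕ → ℕ) (K : ℕ) (t : ℝ) (x : Σ K, SiteSeqKey F (K₀ + K)) :
    bandA₁₃ θ hP K₀ g₀ os ρ n K t x ≤ weightA₁₃ θ hP K₀ g₀ os K t x :=
  Finset.sum_le_sum fun s _ => bandWeightOfDatum₉_le_classWeight F N θ.toStage9Params (datumOfRecord₁₃CoPH F N θ hP) g₀ os (runA₁₃ F K₀ g₀ K)
    (histA₁₃ θ K₀ g₀ K) (K₀ + K) (wOfRecord₉_nonneg θ.toStage9Params hζ0 _ _) _ _ t s (hintA K t s)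

/-- run B: the keyed band never exceeds the keyed class weight. [bookkeeping] -/
theorem bandB₁₃_le_weightB₁₃ (K₀ : ℕ) (θ : Stage13HParams F N) (hP : θ.Provisos₁₃CoPH F N) (g₀ : ℕ → ℝ) (os : List (ULoop F))
    (hζ0 : ∀ p g k s Pl Ql RS U V', 0 ≤ θ.ζ p g k s Pl Ql RS U V')
    (hintB : ∀ (K : ℕ) (t : ℝ) (s' : SeqOfRecord F θ.ν θ.τ9.M (histB₁₃ θ K₀ g₀ K) (K₀ + K + 1) (K₀ + K + 1)),
      Integrable (fun V => chiSeqOfRecord F N θ.ν θ.τ9.M (histB₁₃ θ K₀ g₀ K) (K₀ + K + 1) (K₀ + K + 1) s' V *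
        dressedSlotsOfDatum₉ F N θ.toStage9Params (datumOfRecord₁₃CoPH F N θ hP) g₀ os t (runB₁₃ F K₀ g₀ K) (histB₁₃ θ K₀ g₀ K) (K₀ + K + 1) s' V)
        (fieldMeasure (F.P (K₀ + K + 1)) (K₀ + K + 1) (SU N)))
    (ρ : ℕ → ℝ) (n : ℕ → ℕ) (K : ℕ) (t : ℝ) (x : Σ K, SiteSeqKey F (K₀ + K)) :
    bandB₁₃ θ hP K₀ g₀ os ρ n K t x ≤ weightB₁₃ θ hP K₀ g₀ os K t x :=
  Finset.sum_le_sum fun s' _ => bandWeightOfDatum₉_le_classWeight F N θ.toStage9Params (datumOfRecord₁₃CoPH F N θ hP) g₀ os (runB₁₃ F K₀ g₀ K)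
    (histB₁₃ θ K₀ g₀ K) (K₀ + K + 1) (wOfRecord₉_nonneg θ.toStage9Params hζ0 _ _) _ _ t s' (hintB K t s')

/-! ## §13 At the selected depth both runs' band masses are small — NO anti-concentration -/

/-- ★★ **AT THE SELECTED DEPTH BOTH RUNS' BAND MASSES ARE SMALL.**  At a `CoPH`-keyed Stage-13 tuple and offset `K₀`, for a width sequence with `ρ_K ≤ 1` and any depth
`n`, under (H-U), `0 ≤ ζ` and F3's (e1) integrability of the two runs' top-level pieces: at `i⋆ = selDepth₁₃ … ρ n K t`,
`Σ_s band^A_{i⋆} ≤ (2(2L^m)⁴∕(n+1)) · Σ_s classWeight^A` AND `Σ_s band^B_{i⋆} ≤ (2(2L^m)⁴∕(n+1)) · Σ_s classWeight^B` — §11's pigeonhole in each run and §10's argmin.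
NO `SlotAntiConcentration`, NO estimate of Bałaban's. [bookkeeping] -/
theorem bandSum_selDepth_le (K₀ : ℕ) (θ : Stage13HParams F N) (hP : θ.Provisos₁₃CoPH F N) (g₀ : ℕ → ℝ) (os : List (ULoop F))
    (hU : LocalBgMeasurable F N θ.ν) (hζ0 : ∀ p g k s Pl Ql RS U V', 0 ≤ θ.ζ p g k s Pl Ql RS U V')
    (hintA : ∀ (K : ℕ) (t : ℝ) (s : SeqOfRecord F θ.ν θ.τ9.M (histA₁₃ θ K₀ g₀ K) (K₀ + K) (K₀ + K)),
      Integrable (fun V => chiSeqOfRecord F N θ.ν θ.τ9.M (histA₁₃ θ K₀ g₀ K) (K₀ + K) (K₀ + K) s V *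
        dressedSlotsOfDatum₉ F N θ.toStage9Params (datumOfRecord₁₃CoPH F N θ hP) g₀ os t (runA₁₃ F K₀ g₀ K) (histA₁₃ θ K₀ g₀ K) (K₀ + K) s V)
        (fieldMeasure (F.P (K₀ + K)) (K₀ + K) (SU N)))
    (hintB : ∀ (K : ℕ) (t : ℝ) (s' : SeqOfRecord F θ.ν θ.τ9.M (histB₁₃ θ K₀ g₀ K) (K₀ + K + 1) (K₀ + K + 1)),
      Integrable (fun V => chiSeqOfRecord F N θ.ν θ.τ9.M (histB₁₃ θ K₀ g₀ K) (K₀ + K + 1) (K₀ + K + 1) s' V *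
        dressedSlotsOfDatum₉ F N θ.toStage9Params (datumOfRecord₁₃CoPH F N θ hP) g₀ os t (runB₁₃ F K₀ g₀ K) (histB₁₃ θ K₀ g₀ K) (K₀ + K + 1) s' V)
        (fieldMeasure (F.P (K₀ + K + 1)) (K₀ + K + 1) (SU N)))
    {ρ : ℕ → ℝ} (hρ1 : ∀ K, ρ K ≤ 1) (n K : ℕ) (t : ℝ) :
    bandSumA₁₃ θ hP K₀ g₀ os ρ K (selDepth₁₃ θ hP K₀ g₀ os ρ n K t) t ≤ 2 * (2 * (F.L : ℝ) ^ F.m) ^ 4 / (n + 1 : ℕ) * massA₁₃ θ hP K₀ g₀ os K t ∧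
      bandSumB₁₃ θ hP K₀ g₀ os ρ K (selDepth₁₃ θ hP K₀ g₀ os ρ n K t) t ≤ 2 * (2 * (F.L : ℝ) ^ F.m) ^ 4 / (n + 1 : ℕ) * massB₁₃ θ hP K₀ g₀ os K t := by
  have hw0 : ∀ (p : B12.RunParams) (g : ℕ → ℝ) k s' U V', 0 ≤ wOfRecord₉ F N θ.toStage9Params p g k s' U V' :=
    fun p g => wOfRecord₉_nonneg θ.toStage9Params hζ0 p g
  -- the two runs' pigeonholes (§11) and nonnegativities
  have hfA := sum_range_sum_bandWeight_le F N θ.toStage9Params (datumOfRecord₁₃CoPH F N θ hP) g₀ os (runA₁₃ F K₀ g₀ K) (histA₁₃ θ K₀ g₀ K) (K₀ + K)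
    hU (hw0 _ _) rfl (hρ1 K) (n + 1) t (hintA K t)
  have hfB := sum_range_sum_bandWeight_le F N θ.toStage9Params (datumOfRecord₁₃CoPH F N θ hP) g₀ os (runB₁₃ F K₀ g₀ K) (histB₁₃ θ K₀ g₀ K) (K₀ + K + 1)
    hU (hw0 _ _) rfl (hρ1 K) (n + 1) t (hintB K t)
  have hA0 : ∀ i, 0 ≤ bandSumA₁₃ θ hP K₀ g₀ os ρ K i t := fun i => Finset.sum_nonneg fun s _ =>
    bandWeightOfDatum₉_nonneg F N θ.toStage9Params (datumOfRecord₁₃CoPH F N θ hP) g₀ os (runA₁₃ F K₀ g₀ K) (histA₁₃ θ K₀ g₀ K) (K₀ + K) (hw0 _ _) _ _ t s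
  have hB0 : ∀ i, 0 ≤ bandSumB₁₃ θ hP K₀ g₀ os ρ K i t := fun i => Finset.sum_nonneg fun s' _ =>
    bandWeightOfDatum₉_nonneg F N θ.toStage9Params (datumOfRecord₁₃CoPH F N θ hP) g₀ os (runB₁₃ F K₀ g₀ K) (histB₁₃ θ K₀ g₀ K) (K₀ + K + 1) (hw0 _ _) _ _ t s'
  have hSA : 0 ≤ massA₁₃ θ hP K₀ g₀ os K t := Finset.sum_nonneg fun s _ =>
    classWeightOfDatum₉_nonneg' F N θ.toStage9Params (datumOfRecord₁₃CoPH F N θ hP) g₀ os (runA₁₃ F K₀ g₀ K) (histA₁₃ θ K₀ g₀ K) (K₀ + K) (hw0 _ _) t s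
  have hSB : 0 ≤ massB₁₃ θ hP K₀ g₀ os K t := Finset.sum_nonneg fun s' _ =>
    classWeightOfDatum₉_nonneg' F N θ.toStage9Params (datumOfRecord₁₃CoPH F N θ hP) g₀ os (runB₁₃ F K₀ g₀ K) (histB₁₃ θ K₀ g₀ K) (K₀ + K + 1) (hw0 _ _) t s'
  have hspec := selDepth₁₃_spec θ hP K₀ g₀ os ρ n K t
  exact argmin_badness_bounds (f := fun i => bandSumA₁₃ θ hP K₀ g₀ os ρ K i t) (g := fun i => bandSumB₁₃ θ hP K₀ g₀ os ρ K i t) hA0 hB0 hSA hSB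
    (by positivity) hfA hfB hspec.1 hspec.2

/-! ## §14 `ShellWeightBound` at the carriers of record and AT `crOfRecord₁₃At K₀ jcut (shellSplitSelected₁₃At N K₀ ρ n)` — (M1)-free -/

/-- ★★★ **N21's OUTPUT SHAPE AT THE KEYED CARRIERS OF RECORD, (M1)-FREE.**  At a `CoPH`-keyed Stage-13 tuple `(F, θ, hP, g₀, os)` and offset `K₀`, with the SELECTED
shell split (`bandA₁₃ ∕ bandB₁₃` at one width sequence `ρ` and depth sequence `n`): DISPLAYED — (H-U) `LocalBgMeasurable θ.ν`, `0 ≤ ζ`, F3's (e1) integrability of the two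
runs' top-level pieces, and the two LETTER rows `ρ_K ≤ 1`, `Summable (K ↦ 1∕(n_K + 1))`.  THEN `ShellWeightBound 1 (classSet₁₃ θ K₀ g₀) (weightA₁₃ …) (weightB₁₃ …)
(bandA₁₃ … ρ n) (bandB₁₃ … ρ n) (K ↦ 2(2L^m)⁴·(1∕(n_K + 1)))` — every field PROVED here; NO anti-concentration, NO estimate of Bałaban's. [bookkeeping] -/
theorem shellWeightBound_classSet₁₃_selected (K₀ : ℕ) (θ : Stage13HParams F N) (hP : θ.Provisos₁₃CoPH F N) (g₀ : ℕ → ℝ) (os : List (ULoop F))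
    (hU : LocalBgMeasurable F N θ.ν) (hζ0 : ∀ p g k s Pl Ql RS U V', 0 ≤ θ.ζ p g k s Pl Ql RS U V')
    (hintA : ∀ (K : ℕ) (t : ℝ) (s : SeqOfRecord F θ.ν θ.τ9.M (histA₁₃ θ K₀ g₀ K) (K₀ + K) (K₀ + K)),
      Integrable (fun V => chiSeqOfRecord F N θ.ν θ.τ9.M (histA₁₃ θ K₀ g₀ K) (K₀ + K) (K₀ + K) s V *
        dressedSlotsOfDatum₉ F N θ.toStage9Params (datumOfRecord₁₃CoPH F N θ hP) g₀ os t (runA₁₃ F K₀ g₀ K) (histA₁₃ θ K₀ g₀ K) (K₀ + K) s V)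
        (fieldMeasure (F.P (K₀ + K)) (K₀ + K) (SU N)))
    (hintB : ∀ (K : ℕ) (t : ℝ) (s' : SeqOfRecord F θ.ν θ.τ9.M (histB₁₃ θ K₀ g₀ K) (K₀ + K + 1) (K₀ + K + 1)),
      Integrable (fun V => chiSeqOfRecord F N θ.ν θ.τ9.M (histB₁₃ θ K₀ g₀ K) (K₀ + K + 1) (K₀ + K + 1) s' V *
        dressedSlotsOfDatum₉ F N θ.toStage9Params (datumOfRecord₁₃CoPH F N θ hP) g₀ os t (runB₁₃ F K₀ g₀ K) (histB₁₃ θ K₀ g₀ K) (K₀ + K + 1) s' V)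
        (fieldMeasure (F.P (K₀ + K + 1)) (K₀ + K + 1) (SU N)))
    {ρ : ℕ → ℝ} {n : ℕ → ℕ} (hρ1 : ∀ K, ρ K ≤ 1) (hn : Summable (fun K => 1 / ((n K : ℝ) + 1))) :
    ShellWeightBound 1 (classSet₁₃ θ K₀ g₀) (weightA₁₃ θ hP K₀ g₀ os) (weightB₁₃ θ hP K₀ g₀ os) (bandA₁₃ θ hP K₀ g₀ os ρ n) (bandB₁₃ θ hP K₀ g₀ os ρ n)
      (fun K => 2 * (2 * (F.L : ℝ) ^ F.m) ^ 4 * (1 / ((n K : ℝ) + 1))) := by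
  have hνbar : 0 ≤ 2 * (2 * (F.L : ℝ) ^ F.m) ^ 4 := by positivity
  -- the constant of §13 in product form
  have hconst : ∀ K, 2 * (2 * (F.L : ℝ) ^ F.m) ^ 4 / (n K + 1 : ℕ) = 2 * (2 * (F.L : ℝ) ^ F.m) ^ 4 * (1 / ((n K : ℝ) + 1)) := fun K => by
    push_cast
    ring
  refine
    { nonneg := fun K => mul_nonneg hνbar (by positivity)
      summable := hn.mul_left _
      sh_nonneg_left := fun K t _ x _ => bandA₁₃_nonneg K₀ θ hP g₀ os hζ0 ρ n K t x
      sh_le_left := fun K t _ x _ => bandA₁₃_le_weightA₁₃ K₀ θ hP g₀ os hζ0 hintA ρ n K t x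
      sh_nonneg_right := fun K t _ x _ => bandB₁₃_nonneg K₀ θ hP g₀ os hζ0 ρ n K t x
      sh_le_right := fun K t _ x _ => bandB₁₃_le_weightB₁₃ K₀ θ hP g₀ os hζ0 hintB ρ n K t x
      left := fun K t _ => ?_
      right := fun K t _ => ?_ }
  · rw [sum_classSet₁₃_bandA₁₃, sum_classSet₁₃_weightA₁₃_eq_massA, ← hconst K]
    exact (bandSum_selDepth_le K₀ θ hP g₀ os hU hζ0 hintA hintB hρ1 (n K) K t).1
  · rw [sum_classSet₁₃_bandB₁₃, sum_classSet₁₃_weightB₁₃_eq_massB, ← hconst K]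
    exact (bandSum_selDepth_le K₀ θ hP g₀ os hU hζ0 hintA hintB hρ1 (n K) K t).2

/-- ★★★ **N21's FACE AT THE SPINE READING OF RECORD WITH THE SELECTED SHELL SPLIT, (M1)-FREE**: under the hypotheses of `shellWeightBound_classSet₁₃_selected` (letters
`ρ : WidthLetter₁₃CoPH N`, `n : DepthLetter₁₃CoPH N` read at the tuple), `ShellWeightBound` holds AT `crOfRecord₁₃At K₀ jcut (shellSplitSelected₁₃At N K₀ ρ n)` — its
`l₀, T, A, B, shA, shB` and its CANONICAL `Wsh` (n20-d `shellWeightBound_crOfRecord₁₃At` BY NAME); the large-field cut `jcut` is not read.  See the header for what this split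
is and is NOT worth to a consumer (A6). [bookkeeping] -/
theorem shellWeightBound_crOfRecord₁₃At_shellSplitSelected (K₀ : ℕ) (jcut : ℕ → ℕ) (ρ : WidthLetter₁₃CoPH N) (n : DepthLetter₁₃CoPH N) (θ : Stage13HParams F N)
    (hP : θ.Provisos₁₃CoPH F N) (g₀ : ℕ → ℝ) (os : List (ULoop F))
    (hU : LocalBgMeasurable F N θ.ν) (hζ0 : ∀ p g k s Pl Ql RS U V', 0 ≤ θ.ζ p g k s Pl Ql RS U V')
    (hintA : ∀ (K : ℕ) (t : ℝ) (s : SeqOfRecord F θ.ν θ.τ9.M (histA₁₃ θ K₀ g₀ K) (K₀ + K) (K₀ + K)),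
      Integrable (fun V => chiSeqOfRecord F N θ.ν θ.τ9.M (histA₁₃ θ K₀ g₀ K) (K₀ + K) (K₀ + K) s V *
        dressedSlotsOfDatum₉ F N θ.toStage9Params (datumOfRecord₁₃CoPH F N θ hP) g₀ os t (runA₁₃ F K₀ g₀ K) (histA₁₃ θ K₀ g₀ K) (K₀ + K) s V)
        (fieldMeasure (F.P (K₀ + K)) (K₀ + K) (SU N)))
    (hintB : ∀ (K : ℕ) (t : ℝ) (s' : SeqOfRecord F θ.ν θ.τ9.M (histB₁₃ θ K₀ g₀ K) (K₀ + K + 1) (K₀ + K + 1)),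
      Integrable (fun V => chiSeqOfRecord F N θ.ν θ.τ9.M (histB₁₃ θ K₀ g₀ K) (K₀ + K + 1) (K₀ + K + 1) s' V *
        dressedSlotsOfDatum₉ F N θ.toStage9Params (datumOfRecord₁₃CoPH F N θ hP) g₀ os t (runB₁₃ F K₀ g₀ K) (histB₁₃ θ K₀ g₀ K) (K₀ + K + 1) s' V)
        (fieldMeasure (F.P (K₀ + K + 1)) (K₀ + K + 1) (SU N)))
    (hρ1 : ∀ K, ρ F θ hP g₀ os K ≤ 1) (hn : Summable (fun K => 1 / ((n F θ hP g₀ os K : ℝ) + 1))) :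
    ShellWeightBound (crOfRecord₁₃At K₀ jcut (shellSplitSelected₁₃At N K₀ ρ n) F θ hP g₀ os).l₀
      (crOfRecord₁₃At K₀ jcut (shellSplitSelected₁₃At N K₀ ρ n) F θ hP g₀ os).T (crOfRecord₁₃At K₀ jcut (shellSplitSelected₁₃At N K₀ ρ n) F θ hP g₀ os).A
      (crOfRecord₁₃At K₀ jcut (shellSplitSelected₁₃At N K₀ ρ n) F θ hP g₀ os).B (crOfRecord₁₃At K₀ jcut (shellSplitSelected₁₃At N K₀ ρ n) F θ hP g₀ os).shA
      (crOfRecord₁₃At K₀ jcut (shellSplitSelected₁₃At N K₀ ρ n) F θ hP g₀ os).shB (crOfRecord₁₃At K₀ jcut (shellSplitSelected₁₃At N K₀ ρ n) F θ hP g₀ os).Wsh :=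
  shellWeightBound_crOfRecord₁₃At K₀ jcut (shellSplitSelected₁₃At N K₀ ρ n) θ hP g₀ os
    (shellWeightBound_classSet₁₃_selected K₀ θ hP g₀ os hU hζ0 hintA hintB hρ1 hn)

/-- ★★★ **THE SAME ON THE LIVE-SELECTOR LINE — displayed rows = n20-d's extraction rows + the two letter rows, NOTHING ELSE.**  At a tuple on the live-selector line
(`hsel`), under (H-U), (H-ζ), `0 ≤ ζ` (the rows of `keyedExtraction_crOfRecord₁₃At`), `ρ_K ≤ 1` and `Summable (K ↦ 1∕(n_K + 1))`: `ShellWeightBound` AT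
`crOfRecord₁₃At K₀ jcut (shellSplitSelected₁₃At N K₀ ρ n)`.  F3's (e1) integrability is g9 FILE 3 §6's theorem; NO anti-concentration, NO estimate of Bałaban's. [bookkeeping] -/
theorem shellWeightBound_crOfRecord₁₃At_shellSplitSelected_of_liveSel (K₀ : ℕ) (jcut : ℕ → ℕ) (ρ : WidthLetter₁₃CoPH N) (n : DepthLetter₁₃CoPH N)
    (θ : Stage13HParams F N) (hP : θ.Provisos₁₃CoPH F N) (g₀ : ℕ → ℝ) (os : List (ULoop F)) (E : B12.RunParams → ℝ)
    (hsel : θ.ppSel = ppSelLiveOfRecord F N θ.ν θ.τ9 E (wOfRecord₉ F N θ.toStage9Params))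
    (hU : LocalBgMeasurable F N θ.ν) (hζm : ZetaMeasurable F N θ.ζ) (hζ0 : ∀ p g k s Pl Ql RS U V', 0 ≤ θ.ζ p g k s Pl Ql RS U V')
    (hρ1 : ∀ K, ρ F θ hP g₀ os K ≤ 1) (hn : Summable (fun K => 1 / ((n F θ hP g₀ os K : ℝ) + 1))) :
    ShellWeightBound (crOfRecord₁₃At K₀ jcut (shellSplitSelected₁₃At N K₀ ρ n) F θ hP g₀ os).l₀
      (crOfRecord₁₃At K₀ jcut (shellSplitSelected₁₃At N K₀ ρ n) F θ hP g₀ os).T (crOfRecord₁₃At K₀ jcut (shellSplitSelected₁₃At N K₀ ρ n) F θ hP g₀ os).A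
      (crOfRecord₁₃At K₀ jcut (shellSplitSelected₁₃At N K₀ ρ n) F θ hP g₀ os).B (crOfRecord₁₃At K₀ jcut (shellSplitSelected₁₃At N K₀ ρ n) F θ hP g₀ os).shA
      (crOfRecord₁₃At K₀ jcut (shellSplitSelected₁₃At N K₀ ρ n) F θ hP g₀ os).shB (crOfRecord₁₃At K₀ jcut (shellSplitSelected₁₃At N K₀ ρ n) F θ hP g₀ os).Wsh :=
  shellWeightBound_crOfRecord₁₃At_shellSplitSelected K₀ jcut ρ n θ hP g₀ os hU hζ0
    (fun K t s => integrable_topPieceA_of_liveSel K₀ θ hP E hsel hU hζm hζ0 g₀ os K t s)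
    (fun K t s' => integrable_topPieceB_of_liveSel K₀ θ hP E hsel hU hζm hζ0 g₀ os K t s') hρ1 hn

/-- ★★★ **THE SAME WITH THE ROWS THE TREE ALREADY PROVES DISCHARGED — displayed: the live-selector pin `hsel`, (H-ζ), and the two letter rows, NOTHING ELSE.**
(H-U) is K0c's ABSOLUTE theorem `Node00.localBgMeasurable` (p488525); `0 ≤ ζ` follows from the provisos' own rows `zetaUnity ∕ zetaAbs` (this seat's (POS)-ζ
`zetaOfRecord_nonneg`, p496248; dag-n20-w2's `zeta_nonneg_of_provisos₁₃CoPH` is the same sentence).  NO anti-concentration, NO estimate of Bałaban's. [bookkeeping] -/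
theorem shellWeightBound_crOfRecord₁₃At_shellSplitSelected_of_liveSel' (K₀ : ℕ) (jcut : ℕ → ℕ) (ρ : WidthLetter₁₃CoPH N) (n : DepthLetter₁₃CoPH N)
    (θ : Stage13HParams F N) (hP : θ.Provisos₁₃CoPH F N) (g₀ : ℕ → ℝ) (os : List (ULoop F)) (E : B12.RunParams → ℝ)
    (hsel : θ.ppSel = ppSelLiveOfRecord F N θ.ν θ.τ9 E (wOfRecord₉ F N θ.toStage9Params)) (hζm : ZetaMeasurable F N θ.ζ)
    (hρ1 : ∀ K, ρ F θ hP g₀ os K ≤ 1) (hn : Summable (fun K => 1 / ((n F θ hP g₀ os K : ℝ) + 1))) :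
    ShellWeightBound (crOfRecord₁₃At K₀ jcut (shellSplitSelected₁₃At N K₀ ρ n) F θ hP g₀ os).l₀
      (crOfRecord₁₃At K₀ jcut (shellSplitSelected₁₃At N K₀ ρ n) F θ hP g₀ os).T (crOfRecord₁₃At K₀ jcut (shellSplitSelected₁₃At N K₀ ρ n) F θ hP g₀ os).A
      (crOfRecord₁₃At K₀ jcut (shellSplitSelected₁₃At N K₀ ρ n) F θ hP g₀ os).B (crOfRecord₁₃At K₀ jcut (shellSplitSelected₁₃At N K₀ ρ n) F θ hP g₀ os).shA
      (crOfRecord₁₃At K₀ jcut (shellSplitSelected₁₃At N K₀ ρ n) F θ hP g₀ os).shB (crOfRecord₁₃At K₀ jcut (shellSplitSelected₁₃At N K₀ ρ n) F θ hP g₀ os).Wsh :=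
  shellWeightBound_crOfRecord₁₃At_shellSplitSelected_of_liveSel K₀ jcut ρ n θ hP g₀ os E hsel (localBgMeasurable F N θ.ν) hζm
    (fun p g k s Pl Ql RS U V' => zetaOfRecord_nonneg F N θ.ν θ.τ9.M hP.zetaUnity hP.zetaAbs p g k s Pl Ql RS U V') hρ1 hn

end AtRecord

end Summit.QuantumFields.YangMills.Theorems.N21ShellSplitOfRecord13CoPH

end
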